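import Literature.Computability.AlgebraicComplexity.BorderRankMatMulThreeLink
import HarnessLib

/-!
# Borel-fixed `(110)`-candidates of `⟨3,3,3⟩`, X: the kernel verdict kills admissible subspaces

Topic `Literature/Computability/AlgebraicComplexity`. The end of the soundness chain of the kernel
test procedure of `BorderRankMatMulThreeKernel.lean`:

* `MatMul3.IsAdmissible.test_le_of_verdictH` — **an admissible `E ≤ K^{A ⊗ B}` whose encoded
  profile passes the kernel verdict `Ker.verdictH` fails a test**:
  `dim testI E ≤ 15 ∨ dim testK E ≤ 15`.

Proof: `E ≤ model (profile E)` (covering theorem, `BorderRankMatMulThreeCover.lean`),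
`model ≤ kspan` (the span of the kernel's model vectors under the variant of the free block,
`BorderRankMatMulThreeLink.lean`; the verdict guarantees at most one free block), the tests are
monotone, and `dim test (kspan) ≤ Ker.boundT ≤ 15` (`BorderRankMatMulThreeKernelBound.lean`).

## References

* A. Conner, A. Harper, J. M. Landsberg, *New lower bounds for matrix multiplication and `det₃`*,
  Forum Math. Pi 11 (2023) e17, arXiv:1911.07981 — §6. [ConnerHarperLandsberg2023]
-/

noncomputable section

open scoped BigOperators

namespace Literature.Computability.AlgebraicComplexity

namespace BorderApolarity

namespace MatMul3

universe u

variable {K : Type u} [Field K]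

/-- `dcode = 5` exactly for the free type. [folklore] -/
theorem dcode_encodeR_eq_five_iff (R : Finset (Fin 3 × Fin 3)) (δ : ℕ) :
    Ker.dcode (encodeR R) δ = 5 ↔ dtypeOf R δ = .free := by
  rw [dcode_encodeR]
  cases dtypeOf R δ <;> simp

/-- The number of free blocks counted by the kernel is the number of blocks of free type.
[folklore] -/
theorem freeCount_encodeProf (Rf : Fin 3 × Fin 3 → Finset (Fin 3 × Fin 3)) (δf : Fin 3 × Fin 3 → ℕ) :
    Ker.freeCount (encodeProf Rf δf) =
      ((Finset.range 9).filter fun n => dtypeOf (Rf (jkDecode n)) (δf (jkDecode n)) = .free).card := by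
  rw [Ker.freeCount, encodeProf, List.filter_map, List.length_map]
  have : ((Finset.range 9).filter fun n => dtypeOf (Rf (jkDecode n)) (δf (jkDecode n)) = .free).card =
      ((List.range 9).filter fun n => decide (dtypeOf (Rf (jkDecode n)) (δf (jkDecode n)) = .free)).length := by
    rw [Finset.card_def, Finset.filter_val, Finset.range_val, Multiset.range, Multiset.filter_coe,
      Multiset.coe_card]
  rw [this]
  congr 2
  funext n
  simp only [Function.comp_apply, dcode_encodeR_eq_five_iff]

/-- **At most one free block**: if the kernel counts `≤ 1` free blocks, all free blocks coincide.
[folklore] -/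
theorem free_unique {Rf : Fin 3 × Fin 3 → Finset (Fin 3 × Fin 3)} {δf : Fin 3 × Fin 3 → ℕ}
    (h : Ker.freeCount (encodeProf Rf δf) ≤ 1) {jk jk' : Fin 3 × Fin 3}
    (hjk : dtypeOf (Rf jk) (δf jk) = .free) (hjk' : dtypeOf (Rf jk') (δf jk') = .free) : jk = jk' := by
  rw [freeCount_encodeProf] at h
  have hmem : ∀ p : Fin 3 × Fin 3, dtypeOf (Rf p) (δf p) = .free →
      jkCode p ∈ (Finset.range 9).filter fun n => dtypeOf (Rf (jkDecode n)) (δf (jkDecode n)) = .free := by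
    intro p hp
    rw [Finset.mem_filter, Finset.mem_range, jkDecode_jkCode]
    exact ⟨(jkCode_spec p).1, hp⟩
  have hc := Finset.card_le_one.1 h _ (hmem jk hjk) _ (hmem jk' hjk')
  rw [← jkDecode_jkCode jk, ← jkDecode_jkCode jk', hc]

/-- No free block when the kernel counts none. [folklore] -/
theorem not_free_of_freeCount_eq_zero {Rf : Fin 3 × Fin 3 → Finset (Fin 3 × Fin 3)}
    {δf : Fin 3 × Fin 3 → ℕ} (h : Ker.freeCount (encodeProf Rf δf) = 0) (jk : Fin 3 × Fin 3) :
    dtypeOf (Rf jk) (δf jk) ≠ .free := by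
  intro hjk
  rw [freeCount_encodeProf, Finset.card_eq_zero, Finset.filter_eq_empty_iff] at h
  exact h (Finset.mem_range.2 (jkCode_spec jk).1) (by rwa [jkDecode_jkCode])

/-- The model lies in the kernel's span under ANY variant whose plane contains the free diagonals.
[cite: ConnerHarperLandsberg2023, §6] -/
theorem model_le_kspan_of {Rf : Fin 3 × Fin 3 → Finset (Fin 3 × Fin 3)} {δf : Fin 3 × Fin 3 → ℕ}
    (df : Fin 3 × Fin 3 → Fin 3 → K) {var : ℕ} (hvar : var ≤ 3) (α β : K)
    (hfree : ∀ jk, dtypeOf (Rf jk) (δf jk) = .free →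
      df jk ∈ Submodule.span K ({(fun _ => (1 : K)), dvar var α β} : Set (Fin 3 → K))) :
    model Rf δf df ≤ kspan (encodeProf Rf δf) var α β :=
  iSup_le fun jk => blockModel_le_kspan jk (df jk) hvar α β (hfree jk)

/-- Core of the verdict: an admissible `E` inside the kernel's span of its profile under a variant
with certified bound `≤ 15` fails that test. [cite: ConnerHarperLandsberg2023, §6] -/
theorem IsAdmissible.test_le_of_boundT [CharZero K] {E : Submodule K (I9' × I9' → K)}
    (hE : IsAdmissible E) {var : ℕ} (hvar : var ≤ 3) (α β : K)
    (hfree : ∀ jk, dtypeOf (rootSet E jk.1 jk.2) (δOf E jk) = .free →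
      dOf E jk ∈ Submodule.span K ({(fun _ => (1 : K)), dvar var α β} : Set (Fin 3 → K)))
    (hgen : (decide (0 < Ker.freeCount (encodeProf (fun jk => rootSet E jk.1 jk.2) (δOf E))) &&
      var == 0) = true → α ≠ 0 ∧ β ≠ 0 ∧ α ≠ β)
    (tk : Bool) (hb : Ker.boundT (encodeProf (fun jk => rootSet E jk.1 jk.2) (δOf E)) var tk ≤ 15) :
    Module.finrank K (testI E) ≤ 15 ∨ Module.finrank K (testK E) ≤ 15 := by
  set prof := encodeProf (fun jk => rootSet E jk.1 jk.2) (δOf E) with hprof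
  -- `E ≤ model ≤ kspan`
  have hEk : E ≤ kspan prof var α β :=
    hE.le_model.trans (model_le_kspan_of (Rf := fun jk => rootSet E jk.1 jk.2) (dOf E) hvar α β hfree)
  have hT := Ker.finrank_test_le_boundT prof var tk α β hgen
    (E := kspan prof var α β) (fun v hv => toFun_mem_kspan α β hv) (finrank_kspan_le prof var α β)
  cases tk with
  | false =>
    left
    exact ((Submodule.finrank_mono (testI_mono hEk)).trans hT).trans hb
  | true =>
    right
    exact ((Submodule.finrank_mono (testK_mono hEk)).trans hT).trans hb

/-- **An admissible subspace whose profile passes the kernel verdict fails a test.**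
For an admissible `E` (unit vectors at the roots, the diagonal structure, `dim E ≤ 16`) whose
encoded profile `(rootSet E, δOf E)` has `Ker.verdictH … hints = true`:
`dim testI E ≤ 15 ∨ dim testK E ≤ 15` — so `E` is not the first member of a candidate triple of
border rank `16`. [cite: ConnerHarperLandsberg2023, §6] -/
theorem IsAdmissible.test_le_of_verdictH [CharZero K] {E : Submodule K (I9' × I9' → K)}
    (hE : IsAdmissible E) (hints : List Bool)
    (hv : Ker.verdictH (encodeProf (fun jk => rootSet E jk.1 jk.2) (δOf E)) hints = true) :
    Module.finrank K (testI E) ≤ 15 ∨ Module.finrank K (testK E) ≤ 15 := by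
  classical
  set prof := encodeProf (fun jk => rootSet E jk.1 jk.2) (δOf E) with hprof
  rw [Ker.verdictH, Bool.and_eq_true, decide_eq_true_eq] at hv
  obtain ⟨hfc, hall⟩ := hv
  have hb : ∀ var ∈ (if Ker.freeCount prof = 0 then [0] else [0, 1, 2, 3] : List ℕ),
      Ker.boundT prof var (hints.getD var false) ≤ 15 := fun var hmem =>
    of_decide_eq_true (List.all_eq_true.1 hall var hmem)
  by_cases h0 : Ker.freeCount prof = 0
  · -- no free block: the generic variant with `α = 1, β = 2` (never used)
    refine hE.test_le_of_boundT (var := 0) (by omega) 1 2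
      (fun jk hjk => absurd hjk (not_free_of_freeCount_eq_zero h0 jk)) (fun _ => ?_)
      (hints.getD 0 false) (hb 0 (by rw [if_pos h0]; simp))
    refine ⟨one_ne_zero, two_ne_zero, ?_⟩
    norm_num
  · -- the free block `jk₀` and the variant of its diagonal
    obtain ⟨jk₀, hjk₀⟩ : ∃ jk, dtypeOf (rootSet E jk.1 jk.2) (δOf E jk) = .free := by
      by_contra hne
      push Not at hne
      apply h0
      rw [hprof, freeCount_encodeProf, Finset.card_eq_zero, Finset.filter_eq_empty_iff]
      intro n _ hn
      exact hne _ hn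
    have hfree : ∀ jk, dtypeOf (rootSet E jk.1 jk.2) (δOf E jk) = .free → jk = jk₀ :=
      fun jk hjk => free_unique hfc hjk hjk₀
    set var := varOf (dOf E jk₀) with hvar
    have hvle : var ≤ 3 := varOf_le _
    refine hE.test_le_of_boundT hvle (αOf (dOf E jk₀)) (βOf (dOf E jk₀)) (fun jk hjk => ?_)
      (fun h => ?_) (hints.getD var false) (hb var ?_)
    · rw [hfree jk hjk]
      exact mem_span_dvar (dOf E jk₀)
    · rw [Bool.and_eq_true, decide_eq_true_eq, beq_iff_eq] at h
      exact varOf_zero h.2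
    · rw [if_neg h0]
      interval_cases h : var <;> simp

end MatMul3

end BorderApolarity

end Literature.Computability.AlgebraicComplexity
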